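import Mathlib
import Summits.NavierStokesRegularity.NavierStokesRegularity.Theses.ThinOrFatPincer
import Summits.NavierStokesRegularity.NavierStokesRegularity.Theorems.ThinOrFatPincerClayData
import HarnessLib

/-!
# `ThinOrFatPincer.Assembly` — the route's assembly (item stmt-NavierStokesRegularity-8665; pure logic)

**Statement.** `GenericClay → Inflation → NavierStokesRegularity`.

PROOF. The route file's planner-authored, kernel-checked deciding theorem
`Theses.ThinOrFatPincer.closes : GenericClay → Inflation → KatoToClay → ClayDataInL3 →
NavierStokesRegularity` is applied to the two hypotheses and to the landed proofs of the two
bookkeeping items `KatoToClay` (`thinOrFatPincer_katoToClay_proof`) and `ClayDataInL3`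
(`thinOrFatPincer_clayDataInL3_proof`) of `Theorems/ThinOrFatPincerClayData.lean`.

HONEST FRAMING: glue between the route's own statements (about HYPOTHETICAL objects); nothing
here bears on the regularity problem itself.
-/

noncomputable section

set_option linter.dupNamespace false

namespace Summit.NavierStokesRegularity.NavierStokesRegularity.Theorems

open Summit.NavierStokesRegularity.NavierStokesRegularity.Theses.ThinOrFatPincer in
/-- **Item stmt-NavierStokesRegularity-8665** (`ThinOrFatPincer.Assembly`): generic Clay regularity
plus inflation give Clay (A), by the route file's `closes` fed with the landed Kato ⇒ Clay and
Clay-data-in-`L³` facts. [this file] -/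
theorem thinOrFatPincer_assembly_proof :
    Summit.NavierStokesRegularity.NavierStokesRegularity.Theses.ThinOrFatPincer.Assembly := by
  unfold Summit.NavierStokesRegularity.NavierStokesRegularity.Theses.ThinOrFatPincer.Assembly
  intro hG hI
  exact closes hG hI thinOrFatPincer_katoToClay_proof thinOrFatPincer_clayDataInL3_proof

end Summit.NavierStokesRegularity.NavierStokesRegularity.Theorems

end
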